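import Summits.CriticalPhenomena.PercolationContinuityZ3.Theorems.Transplant.SkelPhiCorridorKGYRegions
import HarnessLib

/-!
# N2 (frames-only node `SamePDropOfSkeletonFrm₁`, OPEN), (C)/(R) columns, (R-44) cure (i) of stmt-g21's LOCATED-2 (2026-08-23T11:54:48Z):
# THE ALONG-PARKING REGIONS OF THE SECOND-AXIS CORRIDOR AS STEP-DEPENDENT BOXES — `Skelφ.kgCorrSchedY_region_park₂_box_step`

`kgCorrSchedY_region_park₂_box` (SkelPhiCorridorKGYRegions :95) bounds the rows of along-parking region `j` below by the step-INDEPENDENT bottom `aBot`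
of the parking phase (≈ 21σ below the arrival); read through the SHEARED fine-0 coordinate (`rdHi₀` subtracts `v·U·row/…`) that row slack costs
`≈ 21·(|v|/n)·s₀` of spurious forward reach, which empties the (R-44) forward-room window `hF 1` at the window of record (stmt-g21 LOCATED-2).  This file gives
the STEP-`j` box: the along lower edge is `aHi j − max (E₀ − j·dec₂) (P + ρ − 1)` with `aHi j = A + j(R′+ρ)` (`ChainPara.ParkPrm.extent_le` — the cores'
along-extent contracts by `dec₂ = sL − 2R′ − ρ` per step down to `P + ρ − 1`; `E₀ = A − aLo0 = 2(q + (N+1)R′) + (N+1)dS + 2(m₁+1)(R′+ρ)`), the other three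
edges verbatim.  With it every phase-3 region reads at most the arrival box's forward fine-0 reach + ≤ 2·s₀, and the window of record closes at `b₀ := 52·s₀`
(stmt's cure (i); no structural change, no new slot).  Cell-free; generic in the slots `(q, W, N, m₁, Wm₂, Wp₂, m₂)`.
builds on p205010 (kernel theorem, internal audit signed; external expert review pending) — nothing in this file uses p205010; nothing here is a claim about the open
node `SamePDropOfSkeletonFrm₁`.
Lane `prim-bschramm`, seat `prim-bschramm-p5` (gen 16; (C) column machinery); helper file (`--supports stmt-CriticalPhenomena-4575 --as helper`).
[cite: KozmaNitzan2024, §4 Lemma 12 (pp. 23–25: arrival in the target box)] [cite: MartineauTassion2017, §4.3 Lemma 4.2]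
-/

noncomputable section

open scoped Classical

namespace Summit.CriticalPhenomena.PercolationContinuityZ3.Theorems.Transplant

namespace Skelφ

open Literature.Probability.Percolation Literature.Probability.LatticeModels SimpleGraph
open Literature.Probability.Percolation.KozmaNitzan.Cells (oth)
open ChainPlanar ChainPara

variable {V : Type}

section KG

variable {n ℓ : ℕ} {h v : ℤ} {R' ρ q W N m₁ Wm₂ Wp₂ m₂ : ℕ} (hn : 1 ≤ n) (hv : |v| ≤ n) (hlay : (n + h.natAbs : ℕ) ≤ (n : ℤ) * ℓ + 1)
  (hP₁ : ParkOK (kgPark₁Y n ℓ h v R' ρ q W N m₁)) (hP₂ : ParkOK (kgPark₂Y n ℓ h v R' ρ q W N m₁ Wm₂ Wp₂ m₂))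
  (hsplit : (Wm₂ : ℤ) + Wp₂ = (kgPark₁Y n ℓ h v R' ρ q W N m₁).aHi (m₁ + 1) - ParkPrm.aLo (kgPark₁Y n ℓ h v R' ρ q W N m₁) (m₁ + 1))

/-- **The step-`j` lower along-edge of a y′-parking core**: `aLo j ≥ A + j(R′+ρ) − max (A − aLo0 − j·(sLo − 2R′ − ρ)) (sHi + ρ − 1)`
(`ParkPrm.extent_le` with `aHi j = A + j(ea + ρ)`). [folklore] -/
theorem yParkPrmW_aLo_ge {a0 A0 : ℤ} (hP : ParkOK (yParkPrmW n ℓ h v R' ρ a0 A0 Wm₂ Wp₂ m₂)) (j : ℕ) :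
    A0 + (j : ℤ) * ((R' : ℤ) + ρ) -
        max (A0 - a0 - (j : ℤ) * ((((n : ℤ) * ℓ - (shearUnit n h : ℕ) + 1) / (shearUnit n h : ℕ)) - 2 * (R' : ℤ) - ρ))
          ((n : ℤ) * ℓ / (shearUnit n h : ℕ) + 1 + ρ - 1) ≤
      ParkPrm.aLo (yParkPrmW n ℓ h v R' ρ a0 A0 Wm₂ Wp₂ m₂) j := by
  have hx := ParkPrm.extent_le hP j
  have e1 : (yParkPrmW n ℓ h v R' ρ a0 A0 Wm₂ Wp₂ m₂).aHi j = A0 + (j : ℤ) * ((R' : ℤ) + ρ) := by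
    simp [ParkPrm.aHi, yParkPrmW]
  have e2 : (yParkPrmW n ℓ h v R' ρ a0 A0 Wm₂ Wp₂ m₂).A - (yParkPrmW n ℓ h v R' ρ a0 A0 Wm₂ Wp₂ m₂).aLo0 -
      (j : ℤ) * ((yParkPrmW n ℓ h v R' ρ a0 A0 Wm₂ Wp₂ m₂).sLo - 2 * ((yParkPrmW n ℓ h v R' ρ a0 A0 Wm₂ Wp₂ m₂).ea : ℤ) -
        ((yParkPrmW n ℓ h v R' ρ a0 A0 Wm₂ Wp₂ m₂).ρ : ℤ)) = A0 - a0 - (j : ℤ) * ((((n : ℤ) * ℓ - (shearUnit n h : ℕ) + 1) / (shearUnit n h : ℕ)) - 2 * (R' : ℤ) - ρ) := by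
    simp [yParkPrmW]
  have e3 : (yParkPrmW n ℓ h v R' ρ a0 A0 Wm₂ Wp₂ m₂).sHi + ((yParkPrmW n ℓ h v R' ρ a0 A0 Wm₂ Wp₂ m₂).ρ : ℤ) - 1 =
      (n : ℤ) * ℓ / (shearUnit n h : ℕ) + 1 + ρ - 1 := by
    simp [yParkPrmW]
  rw [e1, e2, e3] at hx
  linarith

include hn hv hlay hP₁ hP₂ hsplit in
/-- **ALONG-PARKING REGION `N+1+m₁+1+j` AS A STEP-`j` BOX**: rows in `(N+1)·sLo + [A + j(R′+ρ) − max (E₀ − j·dec₂) (P + ρ − 1) − R′ − L, A + j(R′+ρ) + R′ + L]`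
(`A = q + (N+1)R′ + (N+1)dS + (m₁+1)(R′+ρ)`, `E₀ = 2(q + (N+1)R′) + (N+1)dS + 2(m₁+1)(R′+ρ)`, `dec₂ = kgDec₂Y`, `P = ⌊nℓ/U⌋ + 1`, `L = ⌊3nℓ/U⌋ + 1`), columns in
`kgC₂Y … 0 + [−Wm₂ − j(R′+ρ+|v|) − R′ − n, Wp₂ + j(R′+ρ+|v|) + R′ + n]`. [this work] -/
theorem kgCorrSchedY_region_park₂_box_step (j : ℕ) {y : Site 2} (hy : y ∈ (kgCorrSchedY hn hv hlay hP₁ hP₂ hsplit).region (N + 1 + m₁ + 1 + j)) :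
    ((N : ℤ) + 1) * (((n : ℤ) * ℓ - (shearUnit n h : ℕ) + 1) / (shearUnit n h : ℕ)) + ((q : ℤ) + (N + 1) * R' + (N + 1) * (dS n ℓ h : ℕ)) +
        ((m₁ : ℤ) + 1) * (R' + ρ) + (j : ℤ) * (R' + ρ) -
        max (2 * ((q : ℤ) + (N + 1) * R') + (N + 1) * (dS n ℓ h : ℕ) + 2 * (((m₁ : ℤ) + 1) * (R' + ρ)) - (j : ℤ) * ((((n : ℤ) * ℓ - (shearUnit n h : ℕ) + 1) / (shearUnit n h : ℕ)) - 2 * (R' : ℤ) - ρ))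
          ((n : ℤ) * ℓ / (shearUnit n h : ℕ) + 1 + ρ - 1) -
        R' - ((3 * (n * ℓ) / shearUnit n h + 1 : ℕ) : ℤ) ≤ y 1 ∧
    y 1 ≤ ((N : ℤ) + 1) * (((n : ℤ) * ℓ - (shearUnit n h : ℕ) + 1) / (shearUnit n h : ℕ)) + ((q : ℤ) + (N + 1) * R' + (N + 1) * (dS n ℓ h : ℕ)) +
        ((m₁ : ℤ) + 1) * (R' + ρ) + (j : ℤ) * (R' + ρ) + R' + ((3 * (n * ℓ) / shearUnit n h + 1 : ℕ) : ℤ) ∧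
    kgC₂Y n ℓ h v R' ρ q W N m₁ Wp₂ 0 - Wm₂ - (j : ℤ) * (R' + ρ + |v|) - R' - n ≤ y 0 ∧
    y 0 ≤ kgC₂Y n ℓ h v R' ρ q W N m₁ Wp₂ 0 + Wp₂ + (j : ℤ) * (R' + ρ + |v|) + R' + n := by
  have hg₁ : ((kgPark₁Y n ℓ h v R' ρ q W N m₁).g : ℤ) = R' + ρ := by rw [ParkPrm.g_eq]; simp [kgPark₁Y, xParkPrmW]
  have hbLo : (kgPark₁Y n ℓ h v R' ρ q W N m₁).bLo (m₁ + 1) = -((q : ℤ) + (N + 1) * R') - ((m₁ : ℤ) + 1) * (R' + ρ) := by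
    simp only [ParkPrm.bLo]; push_cast; rw [hg₁]; simp [kgPark₁Y, xParkPrmW]
  have hbHi : (kgPark₁Y n ℓ h v R' ρ q W N m₁).bHi (m₁ + 1) = (q : ℤ) + (N + 1) * R' + (N + 1) * (dS n ℓ h : ℕ) + ((m₁ : ℤ) + 1) * (R' + ρ) := by
    simp only [ParkPrm.bHi]; push_cast; rw [hg₁]; simp [kgPark₁Y, xParkPrmW]
  set a0 := (kgPark₁Y n ℓ h v R' ρ q W N m₁).bLo (m₁ + 1) with ha0def
  set A0 := (kgPark₁Y n ℓ h v R' ρ q W N m₁).bHi (m₁ + 1) with hA0def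
  obtain ⟨hreg, -, -⟩ := kgCorrSchedY_park₂_view hn hv hlay hP₁ hP₂ hsplit j
  rw [hreg] at hy
  obtain ⟨h1, h2, h3, h4⟩ := (mem_yParkC_region_iff hP₂ (kgC₂Y n ℓ h v R' ρ q W N m₁ Wp₂)).1 hy
  rw [← ha0def, ← hA0def] at h1 h2 h3 h4
  have hg₂ : ((yParkPrmW n ℓ h v R' ρ a0 A0 Wm₂ Wp₂ m₂).g : ℤ) =
      R' + ρ + |v| := by rw [ParkPrm.g_eq]; simp [yParkPrmW]
  -- (step-j sharpening) the along-extent of core `j` has contracted: `aLo j ≥ aHi j − max (E₀ − j·dec₂) (sHi + ρ − 1)`, `aHi j = A + j(ea+ρ)`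
  have hlow := yParkPrmW_aLo_ge hP₂ j
  rw [← ha0def, ← hA0def] at hlow
  have hE0 : A0 - a0 = 2 * ((q : ℤ) + (N + 1) * R') + (N + 1) * (dS n ℓ h : ℕ) + 2 * (((m₁ : ℤ) + 1) * (R' + ρ)) := by
    rw [hbHi, hbLo]; ring
  rw [hE0] at hlow
  have hc1 : kgC₂Y n ℓ h v R' ρ q W N m₁ Wp₂ 1 = ((N : ℤ) + 1) * (((n : ℤ) * ℓ - (shearUnit n h : ℕ) + 1) / (shearUnit n h : ℕ)) := by simp [kgC₂Y]
  simp only [ParkPrm.aHi, ParkPrm.bLo, ParkPrm.bHi] at h2 h3 h4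
  rw [hg₂] at h3 h4
  rw [hc1] at h1 h2
  have hea : ((yParkPrmW n ℓ h v R' ρ a0 A0 Wm₂ Wp₂ m₂).ea : ℤ) =
      R' := by simp [yParkPrmW]
  have hLa : ((yParkPrmW n ℓ h v R' ρ a0 A0 Wm₂ Wp₂ m₂).La : ℤ) =
      ((3 * (n * ℓ) / shearUnit n h + 1 : ℕ) : ℤ) := by simp [yParkPrmW]
  have hA : (yParkPrmW n ℓ h v R' ρ a0 A0 Wm₂ Wp₂ m₂).A =
      (q : ℤ) + (N + 1) * R' + (N + 1) * (dS n ℓ h : ℕ) + ((m₁ : ℤ) + 1) * (R' + ρ) := by show A0 = _; exact hbHi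
  have hρ' : ((yParkPrmW n ℓ h v R' ρ a0 A0 Wm₂ Wp₂ m₂).ρ : ℤ) =
      ρ := by simp [yParkPrmW]
  rw [hea, hLa] at h1 h2
  rw [hA, hρ'] at h2
  have heb : ((yParkPrmW n ℓ h v R' ρ a0 A0 Wm₂ Wp₂ m₂).eb : ℤ) =
      R' := by simp [yParkPrmW]
  have hLb : ((yParkPrmW n ℓ h v R' ρ a0 A0 Wm₂ Wp₂ m₂).Lb : ℤ) =
      n := by simp [yParkPrmW]
  have hWm : ((yParkPrmW n ℓ h v R' ρ a0 A0 Wm₂ Wp₂ m₂).Wm : ℤ) =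
      Wm₂ := by simp [yParkPrmW]
  have hWp : ((yParkPrmW n ℓ h v R' ρ a0 A0 Wm₂ Wp₂ m₂).Wp : ℤ) =
      Wp₂ := by simp [yParkPrmW]
  rw [heb, hLb] at h3 h4
  rw [hWm] at h3; rw [hWp] at h4
  have hj0 : (0 : ℤ) ≤ (j : ℤ) * (R' + ρ) := by positivity
  refine ⟨by linarith, by linarith, by linarith, by linarith⟩


end KG

end Skelφ

end Summit.CriticalPhenomena.PercolationContinuityZ3.Theorems.Transplant

end
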